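import Literature.MathematicalPhysics.QuantumFieldTheory.Balaban1983to89.B7BlockGeometry

/-!
# T4 node O3c (row T4-O3c.E3\*, NE1a-PRINT): ℓ¹ column sums of the printed one-step operators `Q`, `Q″` of
[Balaban1985Averaging] (125), (139)–(141) on the `ℤ^d` block geometry — the counting half of the rate
`θ₁ = L^{1-d}` of NE1a (cell `pub-balaban`, record `t4/T4-EST-O3cNE1a.md`; kernel bookkeeping, NOT summit progress)

CITATION HEADER.  T. Bałaban, «Averaging operations for lattice gauge theories», Commun. Math. Phys. **98**
(1985) 17–51 = `Balaban1985Averaging` (B7; renders `b2b-balaban-ref1/pages/1985-cmp98-averaging/…-p0NN-x2.png`,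
journal page = PDF page + 16, read as images by the author of this file, b2b-balaban-b07-g6):
* p. 36 [PDF 20], (122): «Q(V₀, A, c) = L(Q(V₀)A)_c + C(V₀, A, c)» (the first-order Taylor polynomial of the
  one-step frame-reduced coarse angle is `L` times the linear form `Q(V₀)A`); (125): «(Q₀A)_c = (Q_{V₀}A)_c =
  Σ_{x∈B(c₋)} L^{−(d+1)}(R_{0,c₋}A)([x, x′])» and «∣(Q₀A)_c∣ ≤ ∣A∣ < α₁».
* p. 39 [PDF 23], (139)–(141): «From (124) it is clear that we have the inequalities ∣Q_{V₀}A∣ ≤ Q∣A∣,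
  ∣Q″(V₀)A∣ ≤ C′₁L²α₀Q″∣A∣, (139) where the operator Q is defined as in [2], and Q″ is defined as (Q″A)_c =
  Σ_{b⊂B(c₋)∪B(c₊)} L^{−d}A_b. (140) The constant C′₁ depends on d and L. … (Q″_kA)_c = Σ_{b⊂B^k(c₋)∪B^k(c₊)} η^dA_b,
  c ⊂ Ω^{(k)}, (141)»; (138) and the sentence after it: «From this definition it follows easily that the
  functional derivative coincides with partial derivatives (gradient) of F(A) multiplied by η^{−d}.»
* p. 40 [PDF 24], (147): «δ/δA_b (Q_k(U₀)A)_c = Q_k(U₀; c, b), ∣Q_k(U₀; c, b)∣ ≤ 1 + 2C′₁α₀»; p. 42 [PDF 26],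
  Prop. 5 (156): «∣(δ/δA_b) Q_k(U₀, ηA, c)∣ ≤ 1 + 2C′₁α₀ + C₃∣A∣ < 1 + 2C′₁α₀ + C₃α₁».

WHAT THIS FILE PROVES (all [folklore] counting over the printed index sets, on the tree's `ℤ^d` block
geometry `B7BlockGeometry`: `Qav M` = the operator `Q` of (125)/(139) at block ratio `M` with weight
`M^{-(d+1)}` over the straight segments `[x, x + Me_μ]`, `x ∈ B(c₋)`; `Qdd M` = `Q″` of (140)/(141) with weight
`M^{-d}` over `qppBonds M c` = the bonds of `B(c₋) ∪ B(c₊)`):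
* §1 `card_segmentFibre_le`: a fixed fine bond `b` is hit by at most `M` triples `(c, x, l)` (`c` a coarse bond
  of any finite set `S`, `x ∈ B(c₋)`, `l < M`, `b = (x + l e_{c.2}, c.2)`), whence the ℓ¹ COLUMN SUM
  `sum_Qav_le : Σ_{c∈S} (Q_M f)(c) ≤ M^{-d} · Σ_{b∈T} f b` (`f ≥ 0` on `T ⊇ ⋃_{c∈S} qppBonds M c`).
* §2 `card_coarseFibre_le`: a fixed fine bond lies in `B(c₋) ∪ B(c₊)` for at most `2d` coarse bonds `c`
  (those with `c₋ ∈ {w, w − e_ν}`, `w` the block of `b₋`, `ν = c.2`), whence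
  `sum_Qdd_le : Σ_{c∈S} (Q″_M f)(c) ≤ 2d · M^{-d} · Σ_{b∈T} f b`.
* §3 `colsum_le_of_dominated`: an entrywise domination `∣J c∣ ≤ κ₁ (Q_M f)(c) + κ₂ (Q″_M f)(c)` on `S` gives
  `Σ_{c∈S} ∣J c∣ ≤ (κ₁ + 2dκ₂) M^{-d} Σ_{b∈T} f b`; `colsum_oneBond_le`: for a ONE-BOND `f = s·1_{b₀}` and the
  printed shape `κ₁ = L`, `κ₂ = L·(C′₁L²ε)` ((122) × (139)) this is `Σ_{c∈S} ∣J c∣ ≤ L·L^{-d}·(1 + 2d·C′₁L²ε)·s` —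
  the one-step column-sum bound (T2) of `t4/T4-EST-O3cNE1a.md` §4 (flat part `L · L^{-(d+1)} · L = L^{1-d}`,
  the locality factor `2d` multiplying ONLY the `O(C′₁L²ε)` remainder).
* §4 `colsum_comp_le`: column sums of a composite of nonnegative kernels multiply (the tower product (T3)).

THE UNIT READING these counts serve (documentation, record T4-EST-O3cNE1a §2; [analysis] of the cell, NOT a
claim of this file): with `δ/δA_b = η^{-d} ∂/∂A_b` ((138)) and `U₁ = e^{iηA}` (p. 37), in the natural bond angle
`a_b = ηA_b` the printed (156) reads `‖∂Q_k(U₀, a, c)/∂a_b‖ ≤ η^{d-1}(1 + 2C′₁α₀ + C₃α₁) = L^{(1-d)k}(…)`, i.e. the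
per-level rate `L^{1-d}` of NE1a (`T4AvgDerivBound.LoopDerivBound`) is printed per Jacobian entry; the flat
skeleton of that statement is `∂Q_k(c)/∂a_b = L^{-kd} · #{x ∈ B^k(c₋) : b ∈ [x, x + L^k e_μ]} ≤ L^{k(1-d)}` with
column sum `L^{k(1-d)}` — §1 at `M = L^k` times the factor `L^k` of (122)/(130).

HONEST SCOPE.  Nothing here is a statement about Bałaban's nonlinear operations (14)/(15): the file counts
lattice incidences of the PRINTED index sets and manipulates an ASSUMED entrywise domination (the shape of
(139)); whether (139) holds for (15) is B7's Proposition 3/its proof («From (124) it is clear»), a published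
statement quoted, not re-proved (cell census G-B7-02, G-adv4-6/G-b07g5-1: `C′₁ = C′₁(d, L) ≥ L^{d-2}/48`).
value = kernel-checked counting, NOT summit progress; rung (B)+1 bookkeeping ≠ infinite volume / mass gap / Clay.
-/

namespace Literature.MathematicalPhysics.QuantumFieldTheory.Balaban1983to89.T4AvgJacobianL1

open Finset
open Literature.MathematicalPhysics.QuantumLattice (ZdEdge blockMap blockSites mem_blockSites_iff
  card_blockSites)
open Literature.MathematicalPhysics.QuantumFieldTheory.Balaban1983to89.B7BlockGeometry

variable {d : ℕ}

/-! ## 1. The flat kernel `Q` ((125)/(139)): column multiplicity `≤ M`, column sum `≤ M^{-d}` -/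

/-- COLUMN MULTIPLICITY OF THE SEGMENT FAMILY: for a fixed fine bond `b`, the triples `(c, (x, l))` with `c ∈ S`,
`x ∈ B_M(c₋)`, `l < M` and `(x + l e_{c.2}, c.2) = b` number at most `M` — they inject into `l ∈ range M`
(given `l`, `x = b₋ − l e_μ` and then `c = (block of x, μ)` are forced). [folklore] -/
theorem card_segmentFibre_le (M : ℕ) [NeZero M] (S : Finset (ZdEdge d)) (b : ZdEdge d) :
    ((S.sigma fun c => blockSites M c.1 ×ˢ Finset.range M).filter
        (fun q => (q.2.1 + Pi.single q.1.2 (q.2.2 : ℤ), q.1.2) = b)).card ≤ M := by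
  calc _ ≤ (Finset.range M).card := Finset.card_le_card_of_injOn (fun q => q.2.2) ?_ ?_
    _ = M := Finset.card_range M
  · intro q hq
    simp only [Finset.coe_filter, Finset.mem_sigma, Finset.mem_product, Set.mem_setOf_eq] at hq
    exact Finset.mem_coe.2 hq.1.2.2
  · intro q hq q' hq' h
    simp only [Finset.coe_filter, Finset.mem_sigma, Finset.mem_product, Set.mem_setOf_eq,
      mem_blockSites_iff] at hq hq'
    have h' : q.2.2 = q'.2.2 := h
    obtain ⟨h1, h2⟩ := Prod.ext_iff.1 (hq.2.trans hq'.2.symm)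
    dsimp only at h1 h2
    rw [h', h2] at h1
    have hp1 : q.2.1 = q'.2.1 := add_right_cancel h1
    have hc1 : q.1 = q'.1 := Prod.ext (by rw [← hq.1.2.1, ← hq'.1.2.1, hp1]) h2
    exact Sigma.ext hc1 (heq_of_eq (Prod.ext hp1 h'))

/-- A weight identity: `M^{-(n+1)} · (M · S) = M^{-n} · S`. [folklore] -/
theorem inv_pow_succ_mul' (M : ℝ) (hM : M ≠ 0) (n : ℕ) (S : ℝ) :
    (M ^ (n + 1))⁻¹ * (M * S) = (M ^ n)⁻¹ * S := by
  rw [pow_succ, mul_inv, mul_assoc, inv_mul_cancel_left₀ hM]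

/-- The segment bonds of a coarse bond `c` lie in `qppBonds M c` (the straight contour `[x, x + Me_μ]`,
`x ∈ B(c₋)`, stays in `B(c₋) ∪ B(c₊)`; cf. `B7BlockGeometry.Qav_le_Qdd`). [folklore] -/
theorem segment_mem_qppBonds {M : ℕ} (hM : 0 < M) (c : ZdEdge d) {x : Fin d → ℤ}
    (hx : x ∈ blockSites M c.1) {l : ℕ} (hl : l < M) :
    (x + Pi.single c.2 (l : ℤ), c.2) ∈ qppBonds M c := by
  rw [mem_qppBonds]
  refine ⟨line_mem_twoBlocks hM c.2 hx (by positivity) (by exact_mod_cast hl.le), ?_⟩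
  dsimp only
  rw [add_assoc, ← Pi.single_add]
  exact line_mem_twoBlocks hM c.2 hx (by positivity) (by omega)

/-- ℓ¹ COLUMN SUM OF `Q` ((125)/(139)): for `f ≥ 0` on a set `T` containing the segment bonds of every `c ∈ S`,
`Σ_{c∈S} (Q_M f)(c) ≤ M^{-d} · Σ_{b∈T} f b`.  (Times the factor `L` of (122) at `M = L`: the flat one-step
column sum `L · L^{-(d+1)} · L = L^{1-d}` of T4-EST-O3cNE1a §4 (T2).) [folklore] -/
theorem sum_Qav_le (M : ℕ) (hM : 0 < M) (S T : Finset (ZdEdge d)) (f : ZdEdge d → ℝ)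
    (hT : ∀ c ∈ S, qppBonds M c ⊆ T) (hf : ∀ b ∈ T, 0 ≤ f b) :
    ∑ c ∈ S, Qav M f c ≤ ((M : ℝ) ^ d)⁻¹ * ∑ b ∈ T, f b := by
  haveI : NeZero M := ⟨hM.ne'⟩
  have hMr : (M : ℝ) ≠ 0 := by exact_mod_cast hM.ne'
  have key : ∑ c ∈ S, ∑ p ∈ blockSites M c.1 ×ˢ Finset.range M,
      f (p.1 + Pi.single c.2 (p.2 : ℤ), c.2) ≤ M * ∑ b ∈ T, f b := by
    have h := sum_sum_le_card_mul_sum S (fun c => blockSites M c.1 ×ˢ Finset.range M)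
      (fun c p => (p.1 + Pi.single c.2 (p.2 : ℤ), c.2)) T f M
    refine h ?_ (fun b _ => card_segmentFibre_le M S b) hf
    intro c hc p hp
    rw [Finset.mem_product, Finset.mem_range] at hp
    exact hT c hc (segment_mem_qppBonds hM c hp.1 hp.2)
  calc ∑ c ∈ S, Qav M f c = ((M : ℝ) ^ (d + 1))⁻¹ *
        ∑ c ∈ S, ∑ p ∈ blockSites M c.1 ×ˢ Finset.range M, f (p.1 + Pi.single c.2 (p.2 : ℤ), c.2) := by
        simp_rw [Qav_apply_prod, ← Finset.mul_sum]
    _ ≤ ((M : ℝ) ^ (d + 1))⁻¹ * (M * ∑ b ∈ T, f b) := by gcongr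
    _ = ((M : ℝ) ^ d)⁻¹ * ∑ b ∈ T, f b := inv_pow_succ_mul' _ hMr _ _

/-! ## 2. The locality kernel `Q″` ((140)/(141)): column multiplicity `≤ 2d`, column sum `≤ 2d·M^{-d}` -/

/-- COLUMN MULTIPLICITY OF `Q″`: for a fixed fine bond `b`, the pairs `(c, b')` with `c ∈ S`, `b' ∈ qppBonds M c`,
`b' = b` number at most `2d` — `c = (c₋, ν)` with `c₋ ∈ {w, w − e_ν}`, `w` the scale-`M` block of `b₋`
(the count behind (142) «Q″Q″_j∣A∣ ≦ 2dQ″_{j+1}∣A∣», here for an ARBITRARY finite set of coarse bonds).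
[cite: Balaban1985Averaging, (142) p.39] -/
theorem card_coarseFibre_le (M : ℕ) [NeZero M] (S : Finset (ZdEdge d)) (b : ZdEdge d) :
    ((S.sigma fun c => qppBonds M c).filter (fun q => q.2 = b)).card ≤ 2 * d := by
  set w := blockMap M b.1 with hw
  calc _ ≤ (Finset.univ : Finset (Fin d × Bool)).card :=
        Finset.card_le_card_of_injOn (fun q => (q.1.2, decide (q.1.1 = w))) (fun q _ => by simp) ?_
    _ = 2 * d := by
        rw [Finset.card_univ, Fintype.card_prod, Fintype.card_fin, Fintype.card_bool, mul_comm]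
  intro q hq q' hq' h
  simp only [Finset.coe_filter, Finset.mem_sigma, Set.mem_setOf_eq] at hq hq'
  have h' : (q.1.2, decide (q.1.1 = w)) = (q'.1.2, decide (q'.1.1 = w)) := h
  obtain ⟨hν, hdec⟩ := Prod.ext_iff.1 h'
  dsimp only at hν hdec
  have hwq : w = q.1.1 ∨ w = q.1.1 + Pi.single q.1.2 1 := by
    have := ((mem_qppBonds M).1 hq.1.2).1
    rw [mem_twoBlocks_iff, hq.2] at this
    exact this
  have hwq' : w = q'.1.1 ∨ w = q'.1.1 + Pi.single q'.1.2 1 := by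
    have := ((mem_qppBonds M).1 hq'.1.2).1
    rw [mem_twoBlocks_iff, hq'.2] at this
    exact this
  have hc1 : q.1.1 = q'.1.1 := by
    by_cases e1 : q.1.1 = w
    · by_cases e2 : q'.1.1 = w
      · rw [e1, e2]
      · simp [e1, e2] at hdec
    · by_cases e2 : q'.1.1 = w
      · simp [e1, e2] at hdec
      · have a1 : w = q.1.1 + Pi.single q.1.2 1 := hwq.resolve_left (Ne.symm e1)
        have a2 : w = q'.1.1 + Pi.single q'.1.2 1 := hwq'.resolve_left (Ne.symm e2)
        rw [hν] at a1
        exact add_right_cancel (a1.symm.trans a2)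
  exact Sigma.ext (Prod.ext hc1 hν) (heq_of_eq (hq.2.trans hq'.2.symm))

/-- ℓ¹ COLUMN SUM OF `Q″` ((140)/(141)): for `f ≥ 0` on `T ⊇ ⋃_{c∈S} qppBonds M c`,
`Σ_{c∈S} (Q″_M f)(c) ≤ 2d · M^{-d} · Σ_{b∈T} f b`. [folklore] -/
theorem sum_Qdd_le (M : ℕ) (hM : 0 < M) (S T : Finset (ZdEdge d)) (f : ZdEdge d → ℝ)
    (hT : ∀ c ∈ S, qppBonds M c ⊆ T) (hf : ∀ b ∈ T, 0 ≤ f b) :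
    ∑ c ∈ S, Qdd M f c ≤ 2 * (d : ℝ) * (((M : ℝ) ^ d)⁻¹ * ∑ b ∈ T, f b) := by
  haveI : NeZero M := ⟨hM.ne'⟩
  have key : ∑ c ∈ S, ∑ b ∈ qppBonds M c, f b ≤ (2 * d : ℕ) * ∑ b ∈ T, f b := by
    have h := sum_sum_le_card_mul_sum S (fun c => qppBonds M c) (fun _ b => b) T f (2 * d)
    exact h (fun c hc b hb => hT c hc hb) (fun b _ => card_coarseFibre_le M S b) hf
  calc ∑ c ∈ S, Qdd M f c = ((M : ℝ) ^ d)⁻¹ * ∑ c ∈ S, ∑ b ∈ qppBonds M c, f b := by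
        simp_rw [Qdd_apply', ← Finset.mul_sum]
    _ ≤ ((M : ℝ) ^ d)⁻¹ * ((2 * d : ℕ) * ∑ b ∈ T, f b) := by gcongr
    _ = 2 * (d : ℝ) * (((M : ℝ) ^ d)⁻¹ * ∑ b ∈ T, f b) := by push_cast; ring

/-! ## 3. Column sums under the printed entrywise domination (the shape of (122) × (139)) -/

/-- DOMINATED COLUMN SUM: if `∣J c∣ ≤ κ₁ (Q_M f)(c) + κ₂ (Q″_M f)(c)` for `c ∈ S` (`κ₂ ≥ 0`, `f ≥ 0` on
`T ⊇ ⋃_{c∈S} qppBonds M c`, `κ₁ ≥ 0`), then `Σ_{c∈S} ∣J c∣ ≤ (κ₁ + 2d·κ₂) · M^{-d} · Σ_{b∈T} f b`. [folklore] -/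
theorem colsum_le_of_dominated (M : ℕ) (hM : 0 < M) (S T : Finset (ZdEdge d)) (f : ZdEdge d → ℝ)
    (hT : ∀ c ∈ S, qppBonds M c ⊆ T) (hf : ∀ b ∈ T, 0 ≤ f b) (J : ZdEdge d → ℝ) {κ₁ κ₂ : ℝ}
    (hκ₁ : 0 ≤ κ₁) (hκ₂ : 0 ≤ κ₂) (hJ : ∀ c ∈ S, |J c| ≤ κ₁ * Qav M f c + κ₂ * Qdd M f c) :
    ∑ c ∈ S, |J c| ≤ (κ₁ + 2 * d * κ₂) * (((M : ℝ) ^ d)⁻¹ * ∑ b ∈ T, f b) := by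
  have h1 := sum_Qav_le M hM S T f hT hf
  have h2 := sum_Qdd_le M hM S T f hT hf
  calc ∑ c ∈ S, |J c| ≤ ∑ c ∈ S, (κ₁ * Qav M f c + κ₂ * Qdd M f c) := Finset.sum_le_sum hJ
    _ = κ₁ * ∑ c ∈ S, Qav M f c + κ₂ * ∑ c ∈ S, Qdd M f c := by
        rw [Finset.sum_add_distrib, Finset.mul_sum, Finset.mul_sum]
    _ ≤ κ₁ * (((M : ℝ) ^ d)⁻¹ * ∑ b ∈ T, f b) + κ₂ * (2 * (d : ℝ) * (((M : ℝ) ^ d)⁻¹ * ∑ b ∈ T, f b)) := by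
        gcongr
    _ = (κ₁ + 2 * d * κ₂) * (((M : ℝ) ^ d)⁻¹ * ∑ b ∈ T, f b) := by ring

/-- The sum of a one-bond function `s · 1_{b₀}` over a set containing `b₀` is `s`. [folklore] -/
theorem sum_oneBond (T : Finset (ZdEdge d)) {b₀ : ZdEdge d} (hb₀ : b₀ ∈ T) (s : ℝ) :
    ∑ b ∈ T, (if b = b₀ then s else 0) = s := by
  rw [Finset.sum_ite_eq' T b₀ (fun _ => s), if_pos hb₀]

/-- ONE-STEP COLUMN SUM OF THE JACOBIAN, printed shape (T4-EST-O3cNE1a §4 (T1)–(T2)): if for a ONE-BOND change of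
size `s ≥ 0` at the fine bond `b₀` the coarse entries obey the domination
`∣J c∣ ≤ L·(Q_L f)(c) + L·(C·L²·ε)·(Q″_L f)(c)` (`f = s·1_{b₀}`; the factor `L` of (122), the flat bound and the
remainder bound `C′₁L²α₀Q″` of (139), with `C = C′₁ ≥ 0`, `ε = α₀ ≥ 0` at that level), then
`Σ_{c∈S} ∣J c∣ ≤ L · L^{-d} · (1 + 2d·C·L²·ε) · s` — rate `L^{1-d}` with the locality factor `2d` on the remainder
ONLY. [folklore] -/
theorem colsum_oneBond_le (L : ℕ) (hL : 0 < L) (S T : Finset (ZdEdge d)) {b₀ : ZdEdge d} (hb₀ : b₀ ∈ T)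
    (hT : ∀ c ∈ S, qppBonds L c ⊆ T) {s C ε : ℝ} (hs : 0 ≤ s) (hC : 0 ≤ C) (hε : 0 ≤ ε)
    (J : ZdEdge d → ℝ)
    (hJ : ∀ c ∈ S, |J c| ≤ (L : ℝ) * Qav L (fun b => if b = b₀ then s else 0) c +
        (L : ℝ) * (C * (L : ℝ) ^ 2 * ε) * Qdd L (fun b => if b = b₀ then s else 0) c) :
    ∑ c ∈ S, |J c| ≤ (L : ℝ) * ((L : ℝ) ^ d)⁻¹ * (1 + 2 * d * C * (L : ℝ) ^ 2 * ε) * s := by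
  have hf : ∀ b ∈ T, 0 ≤ (fun b => if b = b₀ then s else 0) b := fun b _ => by
    dsimp only; split_ifs <;> simp [hs]
  have h := colsum_le_of_dominated L hL S T (fun b => if b = b₀ then s else 0) hT hf J
    (by positivity : (0 : ℝ) ≤ L) (by positivity : (0 : ℝ) ≤ (L : ℝ) * (C * (L : ℝ) ^ 2 * ε)) hJ
  rw [sum_oneBond T hb₀ s] at h
  calc ∑ c ∈ S, |J c| ≤ ((L : ℝ) + 2 * d * ((L : ℝ) * (C * (L : ℝ) ^ 2 * ε))) * (((L : ℝ) ^ d)⁻¹ * s) := h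
    _ = (L : ℝ) * ((L : ℝ) ^ d)⁻¹ * (1 + 2 * d * C * (L : ℝ) ^ 2 * ε) * s := by ring

/-! ## 4. Composition: column sums of nonnegative kernels multiply (the tower product (T3)) -/

/-- COLUMN SUMS MULTIPLY UNDER COMPOSITION: for kernels `A : γ → β → ℝ` (nonneg on `S₂ × S₁`) and `B : β → ℝ`
(a nonneg column on `S₁`) with `Σ_{c∈S₂} A c b ≤ a` for every `b ∈ S₁` and `Σ_{b∈S₁} B b ≤ b₀`, the composite
column obeys `Σ_{c∈S₂} Σ_{b∈S₁} A c b · B b ≤ a · b₀` (`a ≥ 0`).  Iterated along the tower this gives the product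
`Π_j L^{1-d}(1 + 2dC′₁L²ε_j)` of T4-EST-O3cNE1a §4 (T3). [folklore] -/
theorem colsum_comp_le {β γ : Type*} (S₁ : Finset β) (S₂ : Finset γ) (A : γ → β → ℝ) (B : β → ℝ)
    {a b₀ : ℝ} (ha : 0 ≤ a) (hB : ∀ b ∈ S₁, 0 ≤ B b)
    (hcolA : ∀ b ∈ S₁, ∑ c ∈ S₂, A c b ≤ a) (hcolB : ∑ b ∈ S₁, B b ≤ b₀) :
    ∑ c ∈ S₂, ∑ b ∈ S₁, A c b * B b ≤ a * b₀ := by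
  rw [Finset.sum_comm]
  calc ∑ b ∈ S₁, ∑ c ∈ S₂, A c b * B b = ∑ b ∈ S₁, (∑ c ∈ S₂, A c b) * B b := by
        refine Finset.sum_congr rfl fun b _ => ?_
        rw [Finset.sum_mul]
    _ ≤ ∑ b ∈ S₁, a * B b := Finset.sum_le_sum fun b hb => mul_le_mul_of_nonneg_right (hcolA b hb) (hB b hb)
    _ = a * ∑ b ∈ S₁, B b := by rw [Finset.mul_sum]
    _ ≤ a * b₀ := mul_le_mul_of_nonneg_left hcolB ha

/-- SUP-ENTRIES TIMES COLUMN SUMS: `∣Σ_{b∈S₁} A c b · B b∣ ≤ m · b₀` when `∣A c b∣ ≤ m` on the column's support and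
`Σ_{b∈S₁} ∣B b∣ ≤ b₀` — the last factor of the tower product (sup-entry of the top Jacobian times the column
sums below it, T4-EST-O3cNE1a §4 (T3)). [folklore] -/
theorem entry_comp_le {β : Type*} (S₁ : Finset β) (A B : β → ℝ) {m b₀ : ℝ} (hm : 0 ≤ m)
    (hA : ∀ b ∈ S₁, |A b| ≤ m) (hB : ∑ b ∈ S₁, |B b| ≤ b₀) :
    |∑ b ∈ S₁, A b * B b| ≤ m * b₀ := by
  calc |∑ b ∈ S₁, A b * B b| ≤ ∑ b ∈ S₁, |A b * B b| := Finset.abs_sum_le_sum_abs _ _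
    _ = ∑ b ∈ S₁, |A b| * |B b| := Finset.sum_congr rfl fun b _ => abs_mul _ _
    _ ≤ ∑ b ∈ S₁, m * |B b| :=
        Finset.sum_le_sum fun b hb => mul_le_mul_of_nonneg_right (hA b hb) (abs_nonneg _)
    _ = m * ∑ b ∈ S₁, |B b| := by rw [Finset.mul_sum]
    _ ≤ m * b₀ := mul_le_mul_of_nonneg_left hB hm

end Literature.MathematicalPhysics.QuantumFieldTheory.Balaban1983to89.T4AvgJacobianL1
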